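import Literature.Probability.RandomPlanarGeometry.HexSAWStripWidthThreeHatAnnihilator
import Literature.Probability.RandomPlanarGeometry.HexSAWStripWidthThreeHatContactRecursion
import HarnessLib

/-!
# The width-three strip: the annihilator `det P` as a polynomial in the surface fugacity `y`, and its `y∂_y` —
# the CONTACT hat sums `Ĉ`, `Ĉ²` of `S₃` obey the order-`24` scalar recurrence of the bridge sums with explicit SOURCES
# (module «WIDTH-THREE HAT CONTACT ANNIHILATOR»)

Topic `Literature/Probability/RandomPlanarGeometry` (continues «WIDTH-THREE HAT ANNIHILATOR» `HexSAWStripWidthThreeHatAnnihilator.lean` —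
`W3.hatD_three_tDet_annihilator : Σ_{r ≤ 24} t_r(x_c, y, x_c⁶y) • D̂(n+1+r) = 0` for every `y ≥ 0`, `W3.tDetThree` (the `68` integer monomials of `det P(λ)`) —
and «WIDTH-THREE HAT CONTACT RECURSION» `HexSAWStripWidthThreeHatContactRecursion.lean` — `W3.hatCD`, `W3.hatC2D` and the `y∂_y` method: the hat bridge slices are
polynomials in `y`, `y∂_y D̂ = Ĉ`, `y∂_y Ĉ = Ĉ²` via `HV.hasDerivAt_LUs`, `HV.mul_derivSum_eq_contactSum`, `HV.hasDerivAt_contactSum`, `HV.mul_derivContactSum_eq`).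
Lane «pcv-sawmu» (CriticalPhenomena venture), a-p2 g29 — step 2 of the width-three contact-VARIANCE programme (`HOME/pub-sawmu-a-p2/g29/DESIGN-W3-VARIANCE.md`).

THE OBSERVATION.  Substituting `x = x_c`, `q = x_c⁶y`, every coefficient of `det P` is HOMOGENEOUS: `t_r(x_c, y, x_c⁶y) = x_c^{48−2r}·p_r(y)` with `p_r ∈ ℤ[y]` of
degree `≤ 7` (`50` nonzero integer coefficients in all, e.g. `p_4 = 10y⁶ + 2y⁷`, `p_21 = −1 − 8y`, `p_24 = 1`).  So the scalar recurrence
`Σ_r t_r(y) D̂(n+1+r; y)_{ab} = 0` is an identity between polynomials in `y` on `[0, ∞)`; applying `y∂_y` once and twice (uniqueness of the derivative near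
`y > 0`) gives, with `ṫ_r := y∂_y t_r = x_c^{48−2r} Σ_m m·c_{r,m}y^m` and `ẗ_r := (y∂_y)²t_r = x_c^{48−2r} Σ_m m²·c_{r,m}y^m`,
`Σ_r t_r Ĉ(n+1+r) = −Σ_r ṫ_r D̂(n+1+r)`  and  `Σ_r t_r Ĉ²(n+1+r) = −2Σ_r ṫ_r Ĉ(n+1+r) − Σ_r ẗ_r D̂(n+1+r)` —
the contact hat sums satisfy the SAME order-`24` recurrence, driven by the lower moments through the `y`-derivatives of `det P` (no adjugate, no matrices).
Source of the frame: W. Feller I (1968) XIII.6 (moments of the number of renewals by differentiating the renewal equation); R. P. Stanley EC1 (2012) §4.1.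
Nothing below is printed.

## What is proved (namespace `Literature.Probability.RandomPlanarGeometry.SAW.HV.W3`; `x = x_c = hexCriticalFugacity`)

* §1 `detYVec r` (the integer table `c_{r,·}`), `detYPoly r y = Σ_{m<8} c_{r,m}y^m`, `detYPolyDot` (`Σ m c y^m`), `detYPolyDDot` (`Σ m² c y^m`),
  ★ `tDetThree_xpow : t_r(x, y, x⁶y) = x^{48−2r}·detYPoly r y` (`r < 25`, every real `x`); `detY`, `detYDot`, `detYDDot` (with the factor `x_c^{48−2r}`).
* §2 `hasDerivAt_detYPoly`, `mul_deriv_detYPoly` (`y·p_r′ = ṗ_r`), `hasDerivAt_detYPolyDot`, `mul_deriv_detYPolyDot`.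
* §3 ★★ `detY_annihilator` — `Σ_{r<25} detY y r · D̂(n+1+r)_{ab} = 0` (`y ≥ 0`; entrywise form of #1457's `hatD_three_tDet_annihilator`);
  ★★★ **`detY_contact_annihilator`** — `Σ_r detY y r · Ĉ(n+1+r)_{ab} + Σ_r detYDot y r · D̂(n+1+r)_{ab} = 0` (`y > 0`);
  ★★★ **`detY_contact_sq_annihilator`** — `Σ_r detY y r · Ĉ²(n+1+r)_{ab} + 2Σ_r detYDot y r · Ĉ(n+1+r)_{ab} + Σ_r detYDDot y r · D̂(n+1+r)_{ab} = 0` (`y > 0`).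

Label: LANE THEOREM (own result of lane «pcv-sawmu», a-p2 g29, 2026-08-28; not in print).  NOT claimed: the asymptotic expansions of `Ĉ`, `Ĉ²` and `σ₃²` (next modules:
«LINEAR RECURRENCE WITH POLYNOMIAL SOURCE» + «WIDTH-THREE CONTACT ASYMPTOTICS / VARIANCE»); anything at `T ≥ 4`.
-/

noncomputable section

open Finset Filter Topology Matrix Literature.Probability.LatticeModels Literature.Probability.Percolation

namespace Literature.Probability.RandomPlanarGeometry.SAW

namespace HV

namespace W3

/-! ## §1 `det P` as a polynomial in `y`: `t_r(x, y, x⁶y) = x^{48−2r}·p_r(y)` -/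

/-- The integer table `c_{r,·} = (c_{r,0}, …, c_{r,7})`: `c_{r,m}` is the coefficient of `y^m` in `p_r(y) = t_r(x, y, x⁶y)/x^{48−2r}` (`50` nonzero entries;
read off the `68` monomials of `W3.tDetThree` by `q = x⁶y`). [cite: Stanley2012EC1, §4.1 Theorem 4.1.1; lane «pcv-sawmu» a-p2 g29 — bookkeeping] -/
def detYVec : ℕ → Fin 8 → ℝ
  | 1 => ![0, 0, 0, 0, 0, 0, 0, -1]
  | 2 => ![0, 0, 0, 0, 0, 0, 1, 2]
  | 3 => ![0, 0, 0, 0, 0, 0, -3, -2]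
  | 4 => ![0, 0, 0, 0, 0, 0, 10, 2]
  | 5 => ![0, 0, 0, 0, 0, -4, -15, -1]
  | 6 => ![0, 0, 0, 0, 0, 14, 13, 0]
  | 7 => ![0, 0, 0, 0, 0, -35, -12, 0]
  | 8 => ![0, 0, 0, 0, 6, 46, 6, 0]
  | 9 => ![0, 0, 0, 0, -27, -36, 0, 0]
  | 10 => ![0, 0, 0, 0, 61, 30, 0, 0]
  | 11 => ![0, 0, 0, -4, -76, -15, 0, 0]
  | 12 => ![0, 0, 0, 28, 55, 0, 0, 0]
  | 13 => ![0, 0, 0, -59, -40, 0, 0, 0]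
  | 14 => ![0, 0, 1, 74, 20, 0, 0, 0]
  | 15 => ![0, 0, -17, -50, 0, 0, 0, 0]
  | 16 => ![0, 0, 32, 30, 0, 0, 0, 0]
  | 17 => ![0, 0, -43, -15, 0, 0, 0, 0]
  | 18 => ![0, 6, 27, 0, 0, 0, 0, 0]
  | 19 => ![0, -9, -12, 0, 0, 0, 0, 0]
  | 20 => ![0, 14, 6, 0, 0, 0, 0, 0]
  | 21 => ![-1, -8, 0, 0, 0, 0, 0, 0]
  | 22 => ![1, 2, 0, 0, 0, 0, 0, 0]
  | 23 => ![-2, -1, 0, 0, 0, 0, 0, 0]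
  | 24 => ![1, 0, 0, 0, 0, 0, 0, 0]
  | _ => ![0, 0, 0, 0, 0, 0, 0, 0]

/-- `p_r(y) = Σ_{m<8} c_{r,m} y^m` — the `y`-polynomial part of the `r`-th coefficient of `det P`. [cite: Stanley2012EC1, §4.1 Theorem 4.1.1; lane «pcv-sawmu» a-p2 g29] -/
def detYPoly (r : ℕ) (y : ℝ) : ℝ := ∑ m : Fin 8, detYVec r m * y ^ (m : ℕ)

/-- `ṗ_r(y) = y·p_r′(y) = Σ_{m<8} m·c_{r,m} y^m`. [cite: Feller1968, XIII.6; lane «pcv-sawmu» a-p2 g29] -/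
def detYPolyDot (r : ℕ) (y : ℝ) : ℝ := ∑ m : Fin 8, ((m : ℕ) : ℝ) * detYVec r m * y ^ (m : ℕ)

/-- `p̈_r(y) = y·ṗ_r′(y) = Σ_{m<8} m²·c_{r,m} y^m`. [cite: Feller1968, XIII.6; lane «pcv-sawmu» a-p2 g29] -/
def detYPolyDDot (r : ℕ) (y : ℝ) : ℝ := ∑ m : Fin 8, ((m : ℕ) : ℝ) ^ 2 * detYVec r m * y ^ (m : ℕ)

/-- ★ **Homogeneity of `det P`**: for every real `x, y` and `r < 25`, `t_r(x, y, x⁶y) = x^{48−2r}·p_r(y)` (25 polynomial identities, by `ring`).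
[cite: Stanley2012EC1, §4.1 Theorem 4.1.1; lane «pcv-sawmu» a-p2 g29 — own bookkeeping] -/
theorem tDetThree_xpow (x y : ℝ) (r : ℕ) (hr : r < 25) : tDetThree x y (x ^ 6 * y) r = x ^ (48 - 2 * r) * detYPoly r y := by
  interval_cases r <;> simp [tDetThree, detYPoly, detYVec, Fin.sum_univ_eight] <;> ring

/-- `t_r(y) := x_c^{48−2r}·p_r(y)` — the `r`-th coefficient of `det P` at `x = x_c`, `q = x_c⁶y`, as a function of `y`. [cite: Stanley2012EC1, §4.1; lane «pcv-sawmu» a-p2 g29] -/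
def detY (y : ℝ) (r : ℕ) : ℝ := hexCriticalFugacity ^ (48 - 2 * r) * detYPoly r y

/-- `ṫ_r(y) := y∂_y t_r(y) = x_c^{48−2r}·ṗ_r(y)`. [cite: Feller1968, XIII.6; lane «pcv-sawmu» a-p2 g29] -/
def detYDot (y : ℝ) (r : ℕ) : ℝ := hexCriticalFugacity ^ (48 - 2 * r) * detYPolyDot r y

/-- `ẗ_r(y) := (y∂_y)² t_r(y) = x_c^{48−2r}·p̈_r(y)`. [cite: Feller1968, XIII.6; lane «pcv-sawmu» a-p2 g29] -/
def detYDDot (y : ℝ) (r : ℕ) : ℝ := hexCriticalFugacity ^ (48 - 2 * r) * detYPolyDDot r y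

/-- `t_r(x_c, y, x_c⁶y) = detY y r` for `r < 25` (plumbing). [cite: Stanley2012EC1, §4.1; lane plumbing] -/
theorem tDetThree_xc_eq_detY (y : ℝ) (r : ℕ) (hr : r < 25) :
    tDetThree hexCriticalFugacity y (hexCriticalFugacity ^ 6 * y) r = detY y r := tDetThree_xpow _ _ r hr

/-! ## §2 Derivatives in `y` -/

/-- `p_r` is differentiable with derivative `Σ_m c_{r,m}·(m y^{m−1})` (plumbing). [cite: Feller1968, XIII.6; lane plumbing] -/
theorem hasDerivAt_detYPoly (r : ℕ) (y : ℝ) :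
    HasDerivAt (detYPoly r) (∑ m : Fin 8, detYVec r m * (((m : ℕ) : ℝ) * y ^ ((m : ℕ) - 1))) y := by
  unfold detYPoly
  exact HasDerivAt.fun_sum fun m _ => (hasDerivAt_pow (m : ℕ) y).const_mul _

/-- `y·p_r′(y) = ṗ_r(y)` (plumbing). [cite: Feller1968, XIII.6; lane plumbing] -/
theorem mul_deriv_detYPoly (r : ℕ) (y : ℝ) :
    y * ∑ m : Fin 8, detYVec r m * (((m : ℕ) : ℝ) * y ^ ((m : ℕ) - 1)) = detYPolyDot r y := by
  unfold detYPolyDot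
  rw [Finset.mul_sum]
  refine Finset.sum_congr rfl fun m _ => ?_
  rcases Nat.eq_zero_or_pos (m : ℕ) with h | h
  · rw [h]; simp
  · calc y * (detYVec r m * (((m : ℕ) : ℝ) * y ^ ((m : ℕ) - 1))) = ((m : ℕ) : ℝ) * detYVec r m * (y * y ^ ((m : ℕ) - 1)) := by ring
      _ = ((m : ℕ) : ℝ) * detYVec r m * y ^ (m : ℕ) := by rw [← pow_succ', Nat.sub_add_cancel h]

/-- `ṗ_r` is differentiable with derivative `Σ_m m·c_{r,m}·(m y^{m−1})` (plumbing). [cite: Feller1968, XIII.6; lane plumbing] -/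
theorem hasDerivAt_detYPolyDot (r : ℕ) (y : ℝ) :
    HasDerivAt (detYPolyDot r) (∑ m : Fin 8, ((m : ℕ) : ℝ) * detYVec r m * (((m : ℕ) : ℝ) * y ^ ((m : ℕ) - 1))) y := by
  unfold detYPolyDot
  exact HasDerivAt.fun_sum fun m _ => (hasDerivAt_pow (m : ℕ) y).const_mul _

/-- `y·ṗ_r′(y) = p̈_r(y)` (plumbing). [cite: Feller1968, XIII.6; lane plumbing] -/
theorem mul_deriv_detYPolyDot (r : ℕ) (y : ℝ) :
    y * ∑ m : Fin 8, ((m : ℕ) : ℝ) * detYVec r m * (((m : ℕ) : ℝ) * y ^ ((m : ℕ) - 1)) = detYPolyDDot r y := by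
  unfold detYPolyDDot
  rw [Finset.mul_sum]
  refine Finset.sum_congr rfl fun m _ => ?_
  rcases Nat.eq_zero_or_pos (m : ℕ) with h | h
  · rw [h]; simp
  · calc y * (((m : ℕ) : ℝ) * detYVec r m * (((m : ℕ) : ℝ) * y ^ ((m : ℕ) - 1)))
        = ((m : ℕ) : ℝ) ^ 2 * detYVec r m * (y * y ^ ((m : ℕ) - 1)) := by ring
      _ = ((m : ℕ) : ℝ) ^ 2 * detYVec r m * y ^ (m : ℕ) := by rw [← pow_succ', Nat.sub_add_cancel h]

/-- `t_r` is differentiable in `y` and `y·t_r′ = ṫ_r` (plumbing: the constant factor `x_c^{48−2r}`). [cite: Feller1968, XIII.6; lane plumbing] -/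
theorem hasDerivAt_detY (y : ℝ) (r : ℕ) : ∃ d : ℝ, HasDerivAt (fun y => detY y r) d y ∧ y * d = detYDot y r := by
  refine ⟨hexCriticalFugacity ^ (48 - 2 * r) * ∑ m : Fin 8, detYVec r m * (((m : ℕ) : ℝ) * y ^ ((m : ℕ) - 1)), ?_, ?_⟩
  · unfold detY; exact (hasDerivAt_detYPoly r y).const_mul _
  · unfold detYDot; rw [← mul_deriv_detYPoly]; ring

/-- `ṫ_r` is differentiable in `y` and `y·ṫ_r′ = ẗ_r` (plumbing). [cite: Feller1968, XIII.6; lane plumbing] -/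
theorem hasDerivAt_detYDot (y : ℝ) (r : ℕ) : ∃ d : ℝ, HasDerivAt (fun y => detYDot y r) d y ∧ y * d = detYDDot y r := by
  refine ⟨hexCriticalFugacity ^ (48 - 2 * r) * ∑ m : Fin 8, ((m : ℕ) : ℝ) * detYVec r m * (((m : ℕ) : ℝ) * y ^ ((m : ℕ) - 1)), ?_, ?_⟩
  · unfold detYDot; exact (hasDerivAt_detYPolyDot r y).const_mul _
  · unfold detYDDot; rw [← mul_deriv_detYPolyDot]; ring

/-! ## §3 The annihilator and its two `y∂_y` derivatives -/

/-- ★★ **The annihilator, entrywise, in `y`-form**: for `y ≥ 0`, all levels `a, b` and all `n`, `Σ_{r<25} t_r(y)·D̂(n+1+r; y)_{ab} = 0`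
(#1457's `hatD_three_tDet_annihilator` read through `tDetThree_xpow`). [cite: Stanley2012EC1, §4.1 Theorem 4.1.1 (iii); lane «pcv-sawmu» a-p2 g28/g29 — own result] -/
theorem detY_annihilator {y : ℝ} (hy : 0 ≤ y) (a b : Fin (2 * 3)) (n : ℕ) :
    ∑ r ∈ range 25, detY y r * hatD 3 y (n + 1 + r) a b = 0 := by
  have h := congr_fun (congr_fun (hatD_three_tDet_annihilator hy n) a) b
  simp only [Matrix.sum_apply, Matrix.smul_apply, smul_eq_mul, Matrix.zero_apply] at h
  rw [← h]
  exact Finset.sum_congr rfl fun r hr => by rw [tDetThree_xc_eq_detY y r (Finset.mem_range.1 hr)]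

/-- ★★★ **The first contact annihilator**: for `y > 0`, all levels `a, b` and all `n`,
`Σ_{r<25} t_r(y)·Ĉ(n+1+r; y)_{ab} + Σ_{r<25} ṫ_r(y)·D̂(n+1+r; y)_{ab} = 0` — the contact hat sums obey the order-`24` recurrence of the bridge sums with
the source `−Σ_r ṫ_r D̂`.  Proof: `detY_annihilator` is an identity of differentiable functions of `y` vanishing on `(0, ∞)`; its derivative vanishes
(uniqueness of the derivative), and `y·∂_y D̂ = Ĉ`, `y·t_r′ = ṫ_r`.
[cite: Feller1968, XIII.6 (moments of the number of renewals by differentiating the renewal equation); Stanley2012EC1, §4.1 Theorem 4.1.1 (iii); lane «pcv-sawmu» a-p2 g29 — own result, not in print] -/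
theorem detY_contact_annihilator {y : ℝ} (hy : 0 < y) (a b : Fin (2 * 3)) (n : ℕ) :
    ∑ r ∈ range 25, detY y r * hatCD y (n + 1 + r) a b + ∑ r ∈ range 25, detYDot y r * hatD 3 y (n + 1 + r) a b = 0 := by
  -- derivative data
  set dU : ℕ → ℝ → ℝ := fun k y =>
    ∑ l ∈ LUset 3 (2 * k + 1) (hatLen k a b) (a : ℕ) (b : ℕ), hexCriticalFugacity ^ (l.length - 1) * ((topCnt 3 l.tail : ℝ) * y ^ (topCnt 3 l.tail - 1))
    with hdU
  have hD : ∀ k (y : ℝ), HasDerivAt (fun y => hatD 3 y k a b) (dU k y) y := fun k y => hasDerivAt_LUs (2 * k + 1) (hatLen k a b) _ _ y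
  have hU : ∀ k, y * dU k y = hatCD y k a b := fun k => by
    rw [hdU]; simp only [hatCD, Matrix.of_apply]; exact mul_derivSum_eq_contactSum _ y
  choose dT hdT hTdot using fun r => hasDerivAt_detY y r
  -- the annihilator as a function of y and its derivative
  set F : ℝ → ℝ := fun y => ∑ r ∈ range 25, detY y r * hatD 3 y (n + 1 + r) a b with hF
  have hFd : HasDerivAt F (∑ r ∈ range 25, (dT r * hatD 3 y (n + 1 + r) a b + detY y r * dU (n + 1 + r) y)) y := by
    rw [hF]
    exact HasDerivAt.fun_sum fun r _ => (hdT r).mul (hD (n + 1 + r) y)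
  have hF0 : F =ᶠ[𝓝 y] fun _ => (0 : ℝ) := by
    filter_upwards [Ioi_mem_nhds hy] with y' hy'
    rw [hF]
    exact detY_annihilator (le_of_lt hy') a b n
  have hzero : ∑ r ∈ range 25, (dT r * hatD 3 y (n + 1 + r) a b + detY y r * dU (n + 1 + r) y) = 0 :=
    (hFd.congr_of_eventuallyEq hF0.symm).unique (hasDerivAt_const y (0 : ℝ))
  -- multiply by y
  have hmul : y * ∑ r ∈ range 25, (dT r * hatD 3 y (n + 1 + r) a b + detY y r * dU (n + 1 + r) y)
      = ∑ r ∈ range 25, detY y r * hatCD y (n + 1 + r) a b + ∑ r ∈ range 25, detYDot y r * hatD 3 y (n + 1 + r) a b := by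
    rw [Finset.mul_sum, ← Finset.sum_add_distrib]
    refine Finset.sum_congr rfl fun r _ => ?_
    rw [← hU (n + 1 + r), ← hTdot r]
    ring
  rw [← hmul, hzero, mul_zero]

/-- ★★★ **The second contact annihilator**: for `y > 0`, all levels `a, b` and all `n`,
`Σ_{r<25} t_r(y)·Ĉ²(n+1+r; y)_{ab} + 2·Σ_{r<25} ṫ_r(y)·Ĉ(n+1+r; y)_{ab} + Σ_{r<25} ẗ_r(y)·D̂(n+1+r; y)_{ab} = 0` — `y∂_y` of `detY_contact_annihilator`
(`y·∂_yĈ = Ĉ²`, `y·ṫ_r′ = ẗ_r`).  With «WIDTH-THREE HAT ANNIHILATOR» this is the closed linear system for the first two contact moments of long `S₃` bridges.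
[cite: Feller1968, XIII.6 (second moment of renewal counts); Stanley2012EC1, §4.1 Theorem 4.1.1 (iii); lane «pcv-sawmu» a-p2 g29 — own result, not in print] -/
theorem detY_contact_sq_annihilator {y : ℝ} (hy : 0 < y) (a b : Fin (2 * 3)) (n : ℕ) :
    ∑ r ∈ range 25, detY y r * hatC2D y (n + 1 + r) a b + 2 * ∑ r ∈ range 25, detYDot y r * hatCD y (n + 1 + r) a b
      + ∑ r ∈ range 25, detYDDot y r * hatD 3 y (n + 1 + r) a b = 0 := by
  set dU : ℕ → ℝ → ℝ := fun k y =>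
    ∑ l ∈ LUset 3 (2 * k + 1) (hatLen k a b) (a : ℕ) (b : ℕ), hexCriticalFugacity ^ (l.length - 1) * ((topCnt 3 l.tail : ℝ) * y ^ (topCnt 3 l.tail - 1))
    with hdU
  set dC : ℕ → ℝ → ℝ := fun k y =>
    ∑ l ∈ LUset 3 (2 * k + 1) (hatLen k a b) (a : ℕ) (b : ℕ),
      (topCnt 3 l.tail : ℝ) * (hexCriticalFugacity ^ (l.length - 1) * ((topCnt 3 l.tail : ℝ) * y ^ (topCnt 3 l.tail - 1))) with hdC
  have hD : ∀ k (y : ℝ), HasDerivAt (fun y => hatD 3 y k a b) (dU k y) y := fun k y => hasDerivAt_LUs (2 * k + 1) (hatLen k a b) _ _ y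
  have hC : ∀ k (y : ℝ), HasDerivAt (fun y => hatCD y k a b) (dC k y) y := fun k y => by
    simp only [hatCD, Matrix.of_apply]; exact hasDerivAt_contactSum _ y
  have hU : ∀ k, y * dU k y = hatCD y k a b := fun k => by
    rw [hdU]; simp only [hatCD, Matrix.of_apply]; exact mul_derivSum_eq_contactSum _ y
  have hC2 : ∀ k, y * dC k y = hatC2D y k a b := fun k => by
    rw [hdC]; simp only [hatC2D, Matrix.of_apply]; exact mul_derivContactSum_eq _ y
  choose dT hdT hTdot using fun r => hasDerivAt_detY y r
  choose dTd hdTd hTddot using fun r => hasDerivAt_detYDot y r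
  set F : ℝ → ℝ := fun y => ∑ r ∈ range 25, detY y r * hatCD y (n + 1 + r) a b + ∑ r ∈ range 25, detYDot y r * hatD 3 y (n + 1 + r) a b
    with hF
  have hFd : HasDerivAt F (∑ r ∈ range 25, (dT r * hatCD y (n + 1 + r) a b + detY y r * dC (n + 1 + r) y)
      + ∑ r ∈ range 25, (dTd r * hatD 3 y (n + 1 + r) a b + detYDot y r * dU (n + 1 + r) y)) y := by
    rw [hF]
    exact (HasDerivAt.fun_sum fun r _ => (hdT r).mul (hC (n + 1 + r) y)).add
      (HasDerivAt.fun_sum fun r _ => (hdTd r).mul (hD (n + 1 + r) y))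
  have hF0 : F =ᶠ[𝓝 y] fun _ => (0 : ℝ) := by
    filter_upwards [Ioi_mem_nhds hy] with y' hy'
    rw [hF]
    exact detY_contact_annihilator hy' a b n
  have hzero : ∑ r ∈ range 25, (dT r * hatCD y (n + 1 + r) a b + detY y r * dC (n + 1 + r) y)
      + ∑ r ∈ range 25, (dTd r * hatD 3 y (n + 1 + r) a b + detYDot y r * dU (n + 1 + r) y) = 0 :=
    (hFd.congr_of_eventuallyEq hF0.symm).unique (hasDerivAt_const y (0 : ℝ))
  have hmul : y * (∑ r ∈ range 25, (dT r * hatCD y (n + 1 + r) a b + detY y r * dC (n + 1 + r) y)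
      + ∑ r ∈ range 25, (dTd r * hatD 3 y (n + 1 + r) a b + detYDot y r * dU (n + 1 + r) y))
      = ∑ r ∈ range 25, detY y r * hatC2D y (n + 1 + r) a b + 2 * ∑ r ∈ range 25, detYDot y r * hatCD y (n + 1 + r) a b
        + ∑ r ∈ range 25, detYDDot y r * hatD 3 y (n + 1 + r) a b := by
    rw [mul_add, Finset.mul_sum, Finset.mul_sum, Finset.mul_sum, ← Finset.sum_add_distrib, ← Finset.sum_add_distrib, ← Finset.sum_add_distrib]
    refine Finset.sum_congr rfl fun r _ => ?_
    rw [← hU (n + 1 + r), ← hC2 (n + 1 + r), ← hTdot r, ← hTddot r]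
    ring
  rw [← hmul, hzero, mul_zero]

end W3

end HV

end Literature.Probability.RandomPlanarGeometry.SAW
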